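import Literature.Computability.AlgebraicComplexity.HashedZeroOut
import Literature.Computability.AlgebraicComplexity.AsymmetricCleanupGeneral
import HarnessLib

/-!
# The holes of the second type of a hashed stage: Claim 5.16 / 6.15, Markov's inequality and the
existence of a good seed, in abstract form (Vassilevska Williams–Xu–Xu–Zhou 2024, §5.6 and §6.6) — proved

Topic `Literature/Computability/AlgebraicComplexity`.  §6.6 of Vassilevska Williams–Xu–Xu–Zhou,
*New bounds for matrix multiplication: from alpha to omega* (SODA 2024, arXiv:2307.07970) repeats for
the constituent stage the probabilistic treatment of the holes "caused by zeroing out `Z_K̂` that are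
compatible with multiple level-`(ℓ−1)` triples" of §5.6: **Claim 6.15** ("The proof of the following
claim is essentially the same as that of (cl:global:prob-of-holes)" = Claim 5.16), the final constraint
`M₀ ≥ (numalpha · p_comp/numzblock) · n²`, linearity of expectation and Markov's inequality, "with
constant probability, it remains in `𝒯'` and the fraction of holes … is `1/n²`".  The tree's
`GlobalStageHoles.lean` proves this for the §5 data; this file PROVES it once for an arbitrary hashed
stage `S : HashedZeroOut c N M` (`HashedZeroOut.lean`) whose universe is a family of level triples with
bounded `X`- and `Y`-degrees (`AsymmetricCleanupGeneral.lean`, Claims 6.6–6.8), as exact counts over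
the seed space `Ω = VxxzSeed M N`:

* `holePairs T`, `hole_subset` — a second-type hole of the copy over a present `T` witnesses a pair
  `(K̂, T')`, `T' ∈ 𝒯α ∖ {T}` through `Z_K` compatible with `K̂`, with `T'` in the bucket of `T`;
* `card_seeds_inBucket_shareZ` — `M^{N−1}` seeds put two triples through the same `Z_K` into a bucket;
* `sum_card_holes_le` — **Claim 5.16 / 6.15 summed**: `∑_ω |holes_ω T| ≤ U(T) · M^{N−1}` over the
  seeds of a bucket (`U(T) = |holePairs T|`, the printed `(numalpha/numzblock) · p_comp` per `K̂`);
* `card_seeds_manyHoles_mul_succ_le` — **Markov**;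
* `card_seeds_good_ge` — with Claim 6.7 (`vxxz2024_claim67`): under `10 · U(T) · M^{N−1} ≤ (h+1) M^N`
  at least half of the `M^N` seeds of a bucket `b ∈ B` make `T` present with at most `h` holes;
* `exists_seed_many_good_copies` — **some seed makes at least `|B| |𝒯α| / (2M²)` triples present with
  at most `h` second-type holes each.**

Everything is proved; one definition (`holePairs`); no named facts.

## References

* V. Vassilevska Williams, Y. Xu, Z. Xu, R. Zhou, *New bounds for matrix multiplication: from alpha
  to omega*, SODA 2024, arXiv:2307.07970 (held: `paper:arxiv-2307.07970`), §6.6 (Claim 6.15, the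
  final constraint on `M₀`, "with constant probability") and §5.6 (Claim 5.16 and its proof, Markov).
  [VassilevskaWilliamsXuXuZhou2024]
-/

noncomputable section

open scoped BigOperators
open Finset

namespace Literature.Computability.AlgebraicComplexity

namespace HashedZeroOut

open scoped Classical

variable {c N M : ℕ} (S : HashedZeroOut c N M)

/-- **The pairs `(K̂, T')` behind the second-type holes of the copy over `T`**: `K̂ ∈ Z_K` useful for
`T`, and `T' ∈ 𝒯α`, `T' ≠ T`, through the same `Z_K`, with which `K̂` is compatible (their number
`U(T)` is the printed `∑_{K̂} (numalpha/numzblock) · p_comp`). [cite: VassilevskaWilliamsXuXuZhou2024, Claim 5.16 / Claim 6.15 (proof)] -/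
def holePairs (T : (Fin N → Fin (2 * c + 1)) × (Fin N → Fin (2 * c + 1)) × (Fin N → Fin (2 * c + 1))) :
    Finset ((Fin N → Fin c → Fin 3) × ((Fin N → Fin (2 * c + 1)) × (Fin N → Fin (2 * c + 1)) × (Fin N → Fin (2 * c + 1)))) :=
  (univ ×ˢ S.𝒯α).filter fun p => blockOfSeq p.1 = T.2.2 ∧ S.UZ T p.1 ∧ p.2 ≠ T ∧ p.2.2.2 = T.2.2 ∧ S.CZ p.2 p.1

variable {S} [Fact M.Prime]

/-- **A hole witnesses a compatible triple in the same bucket.** [cite: VassilevskaWilliamsXuXuZhou2024, Claim 5.16 (proof: "if none of them are mapped to the same bucket … then Z_K̂ is compatible with a unique triple")] -/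
theorem hole_subset (h𝒯 : IsLevelFamily (2 * c) S.𝒯) (hM : M ≠ 2) (hB : ThreeAPFree (S.B : Set (ZMod M))) {ω : VxxzSeed M N}
    {T : (Fin N → Fin (2 * c + 1)) × (Fin N → Fin (2 * c + 1)) × (Fin N → Fin (2 * c + 1))}
    (hT : T ∈ S.present ω) {Kh : Fin N → Fin c → Fin 3} (hK : Kh ∈ S.holes ω T) :
    ∃ T', (Kh, T') ∈ S.holePairs T ∧ InBucket (2 * c) ω T' (vxxzHashX ω (seqVal T.1)) := by
  rw [holes, mem_filter] at hK
  obtain ⟨-, hblk, hu, T', hT'p, hne, hK', hc⟩ := hK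
  refine ⟨T', mem_filter.2 ⟨mem_product.2 ⟨mem_univ _, presentTriples_subset hT'p⟩, hblk, hu, hne, hK', hc⟩, ?_⟩
  have hTb := h𝒯.inBucket_of_mem_hashPresent hM hB (hashPresent_of_mem_presentTriples hT)
  have hT'b := h𝒯.inBucket_of_mem_hashPresent hM hB (hashPresent_of_mem_presentTriples hT'p)
  have e : vxxzHashX ω (seqVal T'.1) = vxxzHashX ω (seqVal T.1) := by
    rw [← hT'b.2.2, ← hTb.2.2, hK']
  rwa [e] at hT'b

/-- Seeds putting two different triples of a level family through the same `Z_K` into bucket `b`: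
`M^{N−1}`. [cite: VassilevskaWilliamsXuXuZhou2024, Claim 5.5 / Claim 6.6 (Z-sharing)] -/
theorem card_seeds_inBucket_shareZ (h𝒯 : IsLevelFamily (2 * c) S.𝒯) (hM : M ≠ 2) (hcM : 2 * c < M) (hN : 0 < N)
    {T T' : (Fin N → Fin (2 * c + 1)) × (Fin N → Fin (2 * c + 1)) × (Fin N → Fin (2 * c + 1))}
    (hT : T ∈ S.𝒯) (hT' : T' ∈ S.𝒯) (hne : T' ≠ T) (h3 : T'.2.2 = T.2.2) (b : ZMod M) :
    (univ.filter fun ω : VxxzSeed M N => InBucket (2 * c) ω T b ∧ InBucket (2 * c) ω T' b).card = M ^ (N - 1) := by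
  have hIJ : (seqVal T.1, seqVal T.2.1) ≠ (seqVal T'.1, seqVal T'.2.1) := by
    intro h
    simp only [Prod.mk.injEq] at h
    apply hne
    have h1 : T'.1 = T.1 := funext fun t => Fin.ext (congrFun h.1 t).symm
    have h2 : T'.2.1 = T.2.1 := funext fun t => Fin.ext (congrFun h.2 t).symm
    exact Prod.ext h1 (Prod.ext h2 h3)
  have h := card_seeds_vxxzHash_bucket_shareZ (n := N) hM (h𝒯 T hT) (I' := seqVal T'.1) (J' := seqVal T'.2.1)
    (by intro t; have := h𝒯 T' hT' t; rw [h3] at this; exact this) (seqVal_lt hcM _) (seqVal_lt hcM _) hIJ b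
  have hM3 : 0 < M ^ 3 := pow_pos (Nat.Prime.pos Fact.out) 3
  refine Nat.eq_of_mul_eq_mul_right hM3 ?_
  have hn' : N - 1 + 3 = N + 2 := by omega
  rw [← pow_add, hn', ← h]
  congr 2
  refine Finset.filter_congr fun ω _ => ?_
  simp only [InBucket, h3]

/-- **Claim 5.16 / 6.15, summed over the useful `Z`-blocks and the seeds of the bucket**:
`∑_ω |holes_ω T| ≤ U(T) · M^{N−1}`. [cite: VassilevskaWilliamsXuXuZhou2024, Claim 6.15 / Claim 5.16 and §5.6 ("linearity of expectation")] -/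
theorem sum_card_holes_le (hS : S.WellFormed) (h𝒯 : IsLevelFamily (2 * c) S.𝒯) (hM : M ≠ 2) (hcM : 2 * c < M) (hN : 0 < N)
    (hB : ThreeAPFree (S.B : Set (ZMod M)))
    {T : (Fin N → Fin (2 * c + 1)) × (Fin N → Fin (2 * c + 1)) × (Fin N → Fin (2 * c + 1))} (hT : T ∈ S.𝒯α) (b : ZMod M) :
    ∑ ω ∈ univ.filter (fun ω : VxxzSeed M N => InBucket (2 * c) ω T b ∧ T ∈ S.present ω), (S.holes ω T).card ≤
      (S.holePairs T).card * M ^ (N - 1) := by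
  have hT𝒯 : T ∈ S.𝒯 := hS.subset hT
  have step1 : ∀ ω : VxxzSeed M N, InBucket (2 * c) ω T b → T ∈ S.present ω →
      (S.holes ω T).card ≤ ((S.holePairs T).filter fun p => InBucket (2 * c) ω T b ∧ InBucket (2 * c) ω p.2 b).card := by
    intro ω hb hp
    refine Finset.card_le_card_of_surjOn Prod.fst fun Kh hKh => ?_
    obtain ⟨T', hp', hb'⟩ := hole_subset h𝒯 hM hB hp (mem_coe.1 hKh)
    refine ⟨(Kh, T'), mem_coe.2 (mem_filter.2 ⟨hp', hb, ?_⟩), rfl⟩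
    rwa [hb.1] at hb'
  calc ∑ ω ∈ univ.filter (fun ω : VxxzSeed M N => InBucket (2 * c) ω T b ∧ T ∈ S.present ω), (S.holes ω T).card
      ≤ ∑ ω ∈ univ.filter (fun ω : VxxzSeed M N => InBucket (2 * c) ω T b ∧ T ∈ S.present ω),
          ((S.holePairs T).filter fun p => InBucket (2 * c) ω T b ∧ InBucket (2 * c) ω p.2 b).card :=
        sum_le_sum fun ω hω => step1 ω (mem_filter.1 hω).2.1 (mem_filter.1 hω).2.2
    _ ≤ ∑ ω : VxxzSeed M N, ((S.holePairs T).filter fun p => InBucket (2 * c) ω T b ∧ InBucket (2 * c) ω p.2 b).card :=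
        sum_le_sum_of_subset_of_nonneg (filter_subset _ _) fun _ _ _ => Nat.zero_le _
    _ = ∑ p ∈ S.holePairs T, (univ.filter fun ω : VxxzSeed M N => InBucket (2 * c) ω T b ∧ InBucket (2 * c) ω p.2 b).card := by
        simp only [card_filter]
        rw [sum_comm]
    _ = ∑ _p ∈ S.holePairs T, M ^ (N - 1) := by
        refine sum_congr rfl fun p hp => ?_
        obtain ⟨hp𝒯, -, -, hne, h3, -⟩ := mem_filter.1 hp
        exact card_seeds_inBucket_shareZ h𝒯 hM hcM hN hT𝒯 (hS.subset (mem_product.1 hp𝒯).2) hne h3 b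
    _ = (S.holePairs T).card * M ^ (N - 1) := by rw [sum_const, smul_eq_mul]

/-- **Markov's inequality** (threshold `h+1`): at most `U(T) M^{N−1}/(h+1)` seeds of the bucket give more
than `h` holes. [cite: VassilevskaWilliamsXuXuZhou2024, §5.6 / §6.6 ("linearity of expectation and Markov's inequality")] -/
theorem card_seeds_manyHoles_mul_succ_le (hS : S.WellFormed) (h𝒯 : IsLevelFamily (2 * c) S.𝒯) (hM : M ≠ 2) (hcM : 2 * c < M)
    (hN : 0 < N) (hB : ThreeAPFree (S.B : Set (ZMod M)))
    {T : (Fin N → Fin (2 * c + 1)) × (Fin N → Fin (2 * c + 1)) × (Fin N → Fin (2 * c + 1))} (hT : T ∈ S.𝒯α) (b : ZMod M) (h : ℕ) :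
    (univ.filter fun ω : VxxzSeed M N =>
        InBucket (2 * c) ω T b ∧ T ∈ S.present ω ∧ h < (S.holes ω T).card).card * (h + 1) ≤
      (S.holePairs T).card * M ^ (N - 1) := by
  calc (univ.filter fun ω : VxxzSeed M N =>
          InBucket (2 * c) ω T b ∧ T ∈ S.present ω ∧ h < (S.holes ω T).card).card * (h + 1)
      = ∑ _ω ∈ univ.filter (fun ω : VxxzSeed M N =>
          InBucket (2 * c) ω T b ∧ T ∈ S.present ω ∧ h < (S.holes ω T).card), (h + 1) := by
        rw [sum_const, smul_eq_mul]
    _ ≤ ∑ ω ∈ univ.filter (fun ω : VxxzSeed M N =>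
          InBucket (2 * c) ω T b ∧ T ∈ S.present ω ∧ h < (S.holes ω T).card), (S.holes ω T).card :=
        sum_le_sum fun ω hω => Nat.succ_le_of_lt (mem_filter.1 hω).2.2.2
    _ ≤ ∑ ω ∈ univ.filter (fun ω : VxxzSeed M N => InBucket (2 * c) ω T b ∧ T ∈ S.present ω), (S.holes ω T).card := by
        refine sum_le_sum_of_subset_of_nonneg (fun ω hω => ?_) fun _ _ _ => Nat.zero_le _
        have h' := mem_filter.1 hω
        exact mem_filter.2 ⟨h'.1, h'.2.1, h'.2.2.1⟩
    _ ≤ (S.holePairs T).card * M ^ (N - 1) := sum_card_holes_le hS h𝒯 hM hcM hN hB hT b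

/-- **The good seeds of a bucket**: under the degree bounds of the cleanup (`8 deg_X ≤ M`, `8 deg_Y ≤ M`
on `𝒯α`) and the final constraint `10 · U(T) · M^{N−1} ≤ (h+1) · M^N`, at least half of the `M^N` seeds
putting `T ∈ 𝒯α` into the bucket `b ∈ B` make `T` present with at most `h` second-type holes
(`3/4 − 1/10 ≥ 1/2`). [cite: VassilevskaWilliamsXuXuZhou2024, §6.6 ("with constant probability, it remains in 𝒯' and the fraction of holes … is 1/n²") and §5.6] -/
theorem card_seeds_good_ge (hS : S.WellFormed) (h𝒯 : IsLevelFamily (2 * c) S.𝒯) (hM : M ≠ 2) (hcM : 2 * c < M) (hN : 0 < N)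
    (hB : ThreeAPFree (S.B : Set (ZMod M)))
    (hdegX : ∀ T ∈ S.𝒯α, 8 * (S.𝒯.filter fun T' => T'.1 = T.1).card ≤ M)
    (hdegY : ∀ T ∈ S.𝒯α, 8 * (S.𝒯.filter fun T' => T'.2.1 = T.2.1).card ≤ M)
    {T : (Fin N → Fin (2 * c + 1)) × (Fin N → Fin (2 * c + 1)) × (Fin N → Fin (2 * c + 1))} (hT : T ∈ S.𝒯α)
    {b : ZMod M} (hb : b ∈ S.B) {h : ℕ} (hU : 10 * ((S.holePairs T).card * M ^ (N - 1)) ≤ (h + 1) * M ^ N) :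
    M ^ N ≤ 2 * (univ.filter fun ω : VxxzSeed M N =>
      T ∈ S.present ω ∧ InBucket (2 * c) ω T b ∧ (S.holes ω T).card ≤ h).card := by
  have hT𝒯 : T ∈ S.𝒯 := hS.subset hT
  have h67 := vxxz2024_claim67 h𝒯 hM hcM hN hT𝒯 (hdegX T hT) (hdegY T hT) b
  set Sv := univ.filter fun ω : VxxzSeed M N => Survives S.𝒯 ω T b with hSv
  set good := univ.filter fun ω : VxxzSeed M N =>
    T ∈ S.present ω ∧ InBucket (2 * c) ω T b ∧ (S.holes ω T).card ≤ h with hgood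
  set bad := univ.filter fun ω : VxxzSeed M N =>
    InBucket (2 * c) ω T b ∧ T ∈ S.present ω ∧ h < (S.holes ω T).card with hbad
  have hcover : Sv ⊆ good ∪ bad := by
    intro ω hω
    rw [hSv, mem_filter] at hω
    have hpres : T ∈ S.present ω := by
      rw [present, h𝒯.presentTriples_eq_filter_survives hM hS.subset ω hB, mem_filter]
      exact ⟨hT, b, hb, hω.2⟩
    have hin : InBucket (2 * c) ω T b := hω.2.1
    rw [mem_union, hgood, hbad, mem_filter, mem_filter]
    by_cases hle : (S.holes ω T).card ≤ h
    · exact Or.inl ⟨mem_univ _, hpres, hin, hle⟩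
    · exact Or.inr ⟨mem_univ _, hin, hpres, Nat.lt_of_not_le hle⟩
  have hSv_le : Sv.card ≤ good.card + bad.card := (card_le_card hcover).trans (card_union_le _ _)
  have hbad_le : 10 * bad.card ≤ M ^ N := by
    have hm := card_seeds_manyHoles_mul_succ_le hS h𝒯 hM hcM hN hB hT b h
    have : 10 * bad.card * (h + 1) ≤ (h + 1) * M ^ N := by
      calc 10 * bad.card * (h + 1) = 10 * (bad.card * (h + 1)) := by ring
        _ ≤ 10 * ((S.holePairs T).card * M ^ (N - 1)) := Nat.mul_le_mul_left _ hm
        _ ≤ (h + 1) * M ^ N := hU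
    rw [mul_comm (h + 1)] at this
    exact Nat.le_of_mul_le_mul_right this (Nat.succ_pos h)
  omega

/-- For a fixed seed, the good pairs `(b, T)` are counted by the good present triples. [cite: VassilevskaWilliamsXuXuZhou2024, §5.2 / §6.2 (buckets)] -/
theorem card_filter_product_good_eq (h𝒯 : IsLevelFamily (2 * c) S.𝒯) (hM : M ≠ 2) (hB : ThreeAPFree (S.B : Set (ZMod M)))
    (hsub : S.𝒯α ⊆ S.𝒯) (ω : VxxzSeed M N) (h : ℕ) :
    ((S.B ×ˢ S.𝒯α).filter fun bT => bT.2 ∈ S.present ω ∧ InBucket (2 * c) ω bT.2 bT.1 ∧ (S.holes ω bT.2).card ≤ h).card =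
      ((S.present ω).filter fun T => (S.holes ω T).card ≤ h).card := by
  refine card_bij (fun bT _ => bT.2) (fun bT hbT => ?_) (fun bT₁ h₁ bT₂ h₂ heq => ?_) (fun T hT => ?_)
  · rw [mem_filter] at hbT
    exact mem_filter.2 ⟨hbT.2.1, hbT.2.2.2⟩
  · rw [mem_filter] at h₁ h₂
    have e : bT₁.1 = bT₂.1 := by
      have e1 := h₁.2.2.1.1
      have e2 := h₂.2.2.1.1
      rw [heq] at e1
      exact e1.symm.trans e2
    exact Prod.ext e heq
  · rw [mem_filter] at hT
    obtain ⟨hTp, hle⟩ := hT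
    have hTα : T ∈ S.𝒯α := presentTriples_subset hTp
    have hsurv : ∃ b ∈ S.B, Survives S.𝒯 ω T b := by
      have := hTp
      rw [present, h𝒯.presentTriples_eq_filter_survives hM hsub ω hB, mem_filter] at this
      exact this.2
    obtain ⟨b, hb, hs⟩ := hsurv
    exact ⟨(b, T), mem_filter.2 ⟨mem_product.2 ⟨hb, hTα⟩, hTp, hs.1, hle⟩, rfl⟩

/-- **Existence of a good seed** (§6.6: "Overall, we expect to get `numalpha · M^{−1−o(1)}` copies of `𝒯*`
whose fraction of holes is `O(1/n²)`", second type, exact form): under the hypotheses of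
`card_seeds_good_ge` for every `T ∈ 𝒯α`, some seed makes at least `|B| |𝒯α| / (2M²)` triples present
with at most `h` second-type holes each. [cite: VassilevskaWilliamsXuXuZhou2024, §6.6 and §5.6] -/
theorem exists_seed_many_good_copies (hS : S.WellFormed) (h𝒯 : IsLevelFamily (2 * c) S.𝒯) (hM : M ≠ 2) (hcM : 2 * c < M)
    (hN : 0 < N) (hB : ThreeAPFree (S.B : Set (ZMod M)))
    (hdegX : ∀ T ∈ S.𝒯α, 8 * (S.𝒯.filter fun T' => T'.1 = T.1).card ≤ M)
    (hdegY : ∀ T ∈ S.𝒯α, 8 * (S.𝒯.filter fun T' => T'.2.1 = T.2.1).card ≤ M) {h : ℕ}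
    (hU : ∀ T ∈ S.𝒯α, 10 * ((S.holePairs T).card * M ^ (N - 1)) ≤ (h + 1) * M ^ N) :
    ∃ ω : VxxzSeed M N, S.B.card * S.𝒯α.card ≤ 2 * M ^ 2 * ((S.present ω).filter fun T => (S.holes ω T).card ≤ h).card := by
  have hsum : S.B.card * S.𝒯α.card * M ^ N ≤ 2 * ∑ ω : VxxzSeed M N,
      ((S.present ω).filter fun T => (S.holes ω T).card ≤ h).card := by
    have hswap : ∑ ω : VxxzSeed M N, ((S.B ×ˢ S.𝒯α).filter fun bT =>
        bT.2 ∈ S.present ω ∧ InBucket (2 * c) ω bT.2 bT.1 ∧ (S.holes ω bT.2).card ≤ h).card =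
        ∑ bT ∈ S.B ×ˢ S.𝒯α, (univ.filter fun ω : VxxzSeed M N =>
          bT.2 ∈ S.present ω ∧ InBucket (2 * c) ω bT.2 bT.1 ∧ (S.holes ω bT.2).card ≤ h).card := by
      simp only [card_filter]
      rw [sum_comm]
    calc S.B.card * S.𝒯α.card * M ^ N = ∑ _bT ∈ S.B ×ˢ S.𝒯α, M ^ N := by
          rw [sum_const, card_product, smul_eq_mul]
      _ ≤ ∑ bT ∈ S.B ×ˢ S.𝒯α, 2 * (univ.filter fun ω : VxxzSeed M N =>
            bT.2 ∈ S.present ω ∧ InBucket (2 * c) ω bT.2 bT.1 ∧ (S.holes ω bT.2).card ≤ h).card :=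
          sum_le_sum fun bT hbT => card_seeds_good_ge hS h𝒯 hM hcM hN hB hdegX hdegY (mem_product.1 hbT).2
            (mem_product.1 hbT).1 (hU _ (mem_product.1 hbT).2)
      _ = 2 * ∑ ω : VxxzSeed M N, ((S.present ω).filter fun T => (S.holes ω T).card ≤ h).card := by
          rw [← mul_sum, ← hswap]
          congr 1
          exact sum_congr rfl fun ω _ => card_filter_product_good_eq h𝒯 hM hB hS.subset ω h
  by_contra hcon
  simp only [not_exists, not_le] at hcon
  have hlt : ∑ ω : VxxzSeed M N, 2 * M ^ 2 * ((S.present ω).filter fun T => (S.holes ω T).card ≤ h).card <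
      ∑ _ω : VxxzSeed M N, S.B.card * S.𝒯α.card :=
    sum_lt_sum_of_nonempty univ_nonempty fun ω _ => hcon ω
  rw [sum_const, card_univ, card_vxxzSeed, smul_eq_mul, ← mul_sum] at hlt
  have : M ^ (N + 2) * (S.B.card * S.𝒯α.card) ≤
      2 * M ^ 2 * ∑ ω : VxxzSeed M N, ((S.present ω).filter fun T => (S.holes ω T).card ≤ h).card := by
    calc M ^ (N + 2) * (S.B.card * S.𝒯α.card) = M ^ 2 * (S.B.card * S.𝒯α.card * M ^ N) := by ring
      _ ≤ M ^ 2 * (2 * ∑ ω : VxxzSeed M N, ((S.present ω).filter fun T => (S.holes ω T).card ≤ h).card) :=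
          Nat.mul_le_mul_left _ hsum
      _ = _ := by ring
  exact absurd (lt_of_le_of_lt this hlt) (lt_irrefl _)

/-! ### The same for the holes inside a set `A` of relevant `Z`-sequences
(§6.6: only the level-1 `Z`-blocks "that appear in the input of the constituent stage" matter — the
others are holes of the first type anyway) -/

variable (S) in
/-- The hole pairs with `K̂` in the relevant set `A`. [cite: VassilevskaWilliamsXuXuZhou2024, §6.6 ("for every level-1 Z-block Z_K̂ that appears in the input of the constituent stage")] -/
def holePairsIn (A : Finset (Fin N → Fin c → Fin 3)) (T : (Fin N → Fin (2 * c + 1)) × (Fin N → Fin (2 * c + 1)) × (Fin N → Fin (2 * c + 1))) :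
    Finset ((Fin N → Fin c → Fin 3) × ((Fin N → Fin (2 * c + 1)) × (Fin N → Fin (2 * c + 1)) × (Fin N → Fin (2 * c + 1)))) :=
  (S.holePairs T).filter fun p => p.1 ∈ A

/-- **Claim 5.16 / 6.15 summed, relevant holes only**: `∑_ω |holes_ω T ∩ A| ≤ U_A(T) · M^{N−1}`.
[cite: VassilevskaWilliamsXuXuZhou2024, Claim 6.15 and §6.6] -/
theorem sum_card_holesIn_le (hS : S.WellFormed) (h𝒯 : IsLevelFamily (2 * c) S.𝒯) (hM : M ≠ 2) (hcM : 2 * c < M) (hN : 0 < N)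
    (hB : ThreeAPFree (S.B : Set (ZMod M))) (A : Finset (Fin N → Fin c → Fin 3))
    {T : (Fin N → Fin (2 * c + 1)) × (Fin N → Fin (2 * c + 1)) × (Fin N → Fin (2 * c + 1))} (hT : T ∈ S.𝒯α) (b : ZMod M) :
    ∑ ω ∈ univ.filter (fun ω : VxxzSeed M N => InBucket (2 * c) ω T b ∧ T ∈ S.present ω), (S.holes ω T ∩ A).card ≤
      (S.holePairsIn A T).card * M ^ (N - 1) := by
  have hT𝒯 : T ∈ S.𝒯 := hS.subset hT
  have step1 : ∀ ω : VxxzSeed M N, InBucket (2 * c) ω T b → T ∈ S.present ω →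
      (S.holes ω T ∩ A).card ≤ ((S.holePairsIn A T).filter fun p => InBucket (2 * c) ω T b ∧ InBucket (2 * c) ω p.2 b).card := by
    intro ω hb hp
    refine Finset.card_le_card_of_surjOn Prod.fst fun Kh hKh => ?_
    obtain ⟨hKh, hKA⟩ := mem_inter.1 (mem_coe.1 hKh)
    obtain ⟨T', hp', hb'⟩ := hole_subset h𝒯 hM hB hp hKh
    refine ⟨(Kh, T'), mem_coe.2 (mem_filter.2 ⟨mem_filter.2 ⟨hp', hKA⟩, hb, ?_⟩), rfl⟩
    rwa [hb.1] at hb'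
  calc ∑ ω ∈ univ.filter (fun ω : VxxzSeed M N => InBucket (2 * c) ω T b ∧ T ∈ S.present ω), (S.holes ω T ∩ A).card
      ≤ ∑ ω ∈ univ.filter (fun ω : VxxzSeed M N => InBucket (2 * c) ω T b ∧ T ∈ S.present ω),
          ((S.holePairsIn A T).filter fun p => InBucket (2 * c) ω T b ∧ InBucket (2 * c) ω p.2 b).card :=
        sum_le_sum fun ω hω => step1 ω (mem_filter.1 hω).2.1 (mem_filter.1 hω).2.2
    _ ≤ ∑ ω : VxxzSeed M N, ((S.holePairsIn A T).filter fun p => InBucket (2 * c) ω T b ∧ InBucket (2 * c) ω p.2 b).card :=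
        sum_le_sum_of_subset_of_nonneg (filter_subset _ _) fun _ _ _ => Nat.zero_le _
    _ = ∑ p ∈ S.holePairsIn A T, (univ.filter fun ω : VxxzSeed M N => InBucket (2 * c) ω T b ∧ InBucket (2 * c) ω p.2 b).card := by
        simp only [card_filter]
        rw [sum_comm]
    _ = ∑ _p ∈ S.holePairsIn A T, M ^ (N - 1) := by
        refine sum_congr rfl fun p hp => ?_
        obtain ⟨hp𝒯, -, -, hne, h3, -⟩ := mem_filter.1 (mem_filter.1 hp).1
        exact card_seeds_inBucket_shareZ h𝒯 hM hcM hN hT𝒯 (hS.subset (mem_product.1 hp𝒯).2) hne h3 b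
    _ = (S.holePairsIn A T).card * M ^ (N - 1) := by rw [sum_const, smul_eq_mul]

/-- **Markov, relevant holes only.** [cite: VassilevskaWilliamsXuXuZhou2024, §5.6 / §6.6] -/
theorem card_seeds_manyHolesIn_mul_succ_le (hS : S.WellFormed) (h𝒯 : IsLevelFamily (2 * c) S.𝒯) (hM : M ≠ 2) (hcM : 2 * c < M)
    (hN : 0 < N) (hB : ThreeAPFree (S.B : Set (ZMod M))) (A : Finset (Fin N → Fin c → Fin 3))
    {T : (Fin N → Fin (2 * c + 1)) × (Fin N → Fin (2 * c + 1)) × (Fin N → Fin (2 * c + 1))} (hT : T ∈ S.𝒯α) (b : ZMod M) (h : ℕ) :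
    (univ.filter fun ω : VxxzSeed M N =>
        InBucket (2 * c) ω T b ∧ T ∈ S.present ω ∧ h < (S.holes ω T ∩ A).card).card * (h + 1) ≤
      (S.holePairsIn A T).card * M ^ (N - 1) := by
  calc (univ.filter fun ω : VxxzSeed M N =>
          InBucket (2 * c) ω T b ∧ T ∈ S.present ω ∧ h < (S.holes ω T ∩ A).card).card * (h + 1)
      = ∑ _ω ∈ univ.filter (fun ω : VxxzSeed M N =>
          InBucket (2 * c) ω T b ∧ T ∈ S.present ω ∧ h < (S.holes ω T ∩ A).card), (h + 1) := by
        rw [sum_const, smul_eq_mul]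
    _ ≤ ∑ ω ∈ univ.filter (fun ω : VxxzSeed M N =>
          InBucket (2 * c) ω T b ∧ T ∈ S.present ω ∧ h < (S.holes ω T ∩ A).card), (S.holes ω T ∩ A).card :=
        sum_le_sum fun ω hω => Nat.succ_le_of_lt (mem_filter.1 hω).2.2.2
    _ ≤ ∑ ω ∈ univ.filter (fun ω : VxxzSeed M N => InBucket (2 * c) ω T b ∧ T ∈ S.present ω), (S.holes ω T ∩ A).card := by
        refine sum_le_sum_of_subset_of_nonneg (fun ω hω => ?_) fun _ _ _ => Nat.zero_le _
        have h' := mem_filter.1 hω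
        exact mem_filter.2 ⟨h'.1, h'.2.1, h'.2.2.1⟩
    _ ≤ (S.holePairsIn A T).card * M ^ (N - 1) := sum_card_holesIn_le hS h𝒯 hM hcM hN hB A hT b

/-- **The good seeds of a bucket, relevant holes only.** [cite: VassilevskaWilliamsXuXuZhou2024, §6.6 and §5.6] -/
theorem card_seeds_goodIn_ge (hS : S.WellFormed) (h𝒯 : IsLevelFamily (2 * c) S.𝒯) (hM : M ≠ 2) (hcM : 2 * c < M) (hN : 0 < N)
    (hB : ThreeAPFree (S.B : Set (ZMod M)))
    (hdegX : ∀ T ∈ S.𝒯α, 8 * (S.𝒯.filter fun T' => T'.1 = T.1).card ≤ M)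
    (hdegY : ∀ T ∈ S.𝒯α, 8 * (S.𝒯.filter fun T' => T'.2.1 = T.2.1).card ≤ M) (A : Finset (Fin N → Fin c → Fin 3))
    {T : (Fin N → Fin (2 * c + 1)) × (Fin N → Fin (2 * c + 1)) × (Fin N → Fin (2 * c + 1))} (hT : T ∈ S.𝒯α)
    {b : ZMod M} (hb : b ∈ S.B) {h : ℕ} (hU : 10 * ((S.holePairsIn A T).card * M ^ (N - 1)) ≤ (h + 1) * M ^ N) :
    M ^ N ≤ 2 * (univ.filter fun ω : VxxzSeed M N =>
      T ∈ S.present ω ∧ InBucket (2 * c) ω T b ∧ (S.holes ω T ∩ A).card ≤ h).card := by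
  have hT𝒯 : T ∈ S.𝒯 := hS.subset hT
  have h67 := vxxz2024_claim67 h𝒯 hM hcM hN hT𝒯 (hdegX T hT) (hdegY T hT) b
  set Sv := univ.filter fun ω : VxxzSeed M N => Survives S.𝒯 ω T b with hSv
  set good := univ.filter fun ω : VxxzSeed M N =>
    T ∈ S.present ω ∧ InBucket (2 * c) ω T b ∧ (S.holes ω T ∩ A).card ≤ h with hgood
  set bad := univ.filter fun ω : VxxzSeed M N =>
    InBucket (2 * c) ω T b ∧ T ∈ S.present ω ∧ h < (S.holes ω T ∩ A).card with hbad
  have hcover : Sv ⊆ good ∪ bad := by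
    intro ω hω
    rw [hSv, mem_filter] at hω
    have hpres : T ∈ S.present ω := by
      rw [present, h𝒯.presentTriples_eq_filter_survives hM hS.subset ω hB, mem_filter]
      exact ⟨hT, b, hb, hω.2⟩
    have hin : InBucket (2 * c) ω T b := hω.2.1
    rw [mem_union, hgood, hbad, mem_filter, mem_filter]
    by_cases hle : (S.holes ω T ∩ A).card ≤ h
    · exact Or.inl ⟨mem_univ _, hpres, hin, hle⟩
    · exact Or.inr ⟨mem_univ _, hin, hpres, Nat.lt_of_not_le hle⟩
  have hSv_le : Sv.card ≤ good.card + bad.card := (card_le_card hcover).trans (card_union_le _ _)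
  have hbad_le : 10 * bad.card ≤ M ^ N := by
    have hm := card_seeds_manyHolesIn_mul_succ_le hS h𝒯 hM hcM hN hB A hT b h
    have : 10 * bad.card * (h + 1) ≤ (h + 1) * M ^ N := by
      calc 10 * bad.card * (h + 1) = 10 * (bad.card * (h + 1)) := by ring
        _ ≤ 10 * ((S.holePairsIn A T).card * M ^ (N - 1)) := Nat.mul_le_mul_left _ hm
        _ ≤ (h + 1) * M ^ N := hU
    rw [mul_comm (h + 1)] at this
    exact Nat.le_of_mul_le_mul_right this (Nat.succ_pos h)
  omega

/-- Good pairs `(b, T)` vs good present triples, relevant holes only. [cite: VassilevskaWilliamsXuXuZhou2024, §5.2 / §6.2 (buckets)] -/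
theorem card_filter_product_goodIn_eq (h𝒯 : IsLevelFamily (2 * c) S.𝒯) (hM : M ≠ 2) (hB : ThreeAPFree (S.B : Set (ZMod M)))
    (hsub : S.𝒯α ⊆ S.𝒯) (A : Finset (Fin N → Fin c → Fin 3)) (ω : VxxzSeed M N) (h : ℕ) :
    ((S.B ×ˢ S.𝒯α).filter fun bT => bT.2 ∈ S.present ω ∧ InBucket (2 * c) ω bT.2 bT.1 ∧ (S.holes ω bT.2 ∩ A).card ≤ h).card =
      ((S.present ω).filter fun T => (S.holes ω T ∩ A).card ≤ h).card := by
  refine card_bij (fun bT _ => bT.2) (fun bT hbT => ?_) (fun bT₁ h₁ bT₂ h₂ heq => ?_) (fun T hT => ?_)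
  · rw [mem_filter] at hbT
    exact mem_filter.2 ⟨hbT.2.1, hbT.2.2.2⟩
  · rw [mem_filter] at h₁ h₂
    have e : bT₁.1 = bT₂.1 := by
      have e1 := h₁.2.2.1.1
      have e2 := h₂.2.2.1.1
      rw [heq] at e1
      exact e1.symm.trans e2
    exact Prod.ext e heq
  · rw [mem_filter] at hT
    obtain ⟨hTp, hle⟩ := hT
    have hTα : T ∈ S.𝒯α := presentTriples_subset hTp
    have hsurv : ∃ b ∈ S.B, Survives S.𝒯 ω T b := by
      have := hTp
      rw [present, h𝒯.presentTriples_eq_filter_survives hM hsub ω hB, mem_filter] at this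
      exact this.2
    obtain ⟨b, hb, hs⟩ := hsurv
    exact ⟨(b, T), mem_filter.2 ⟨mem_product.2 ⟨hb, hTα⟩, hTp, hs.1, hle⟩, rfl⟩

/-- **Existence of a good seed, relevant holes only**: some seed makes at least `|B| |𝒯α| / (2M²)`
triples present with at most `h` second-type holes inside `A` each. [cite: VassilevskaWilliamsXuXuZhou2024, §6.6 and §5.6] -/
theorem exists_seed_many_goodIn_copies (hS : S.WellFormed) (h𝒯 : IsLevelFamily (2 * c) S.𝒯) (hM : M ≠ 2) (hcM : 2 * c < M)
    (hN : 0 < N) (hB : ThreeAPFree (S.B : Set (ZMod M)))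
    (hdegX : ∀ T ∈ S.𝒯α, 8 * (S.𝒯.filter fun T' => T'.1 = T.1).card ≤ M)
    (hdegY : ∀ T ∈ S.𝒯α, 8 * (S.𝒯.filter fun T' => T'.2.1 = T.2.1).card ≤ M) (A : Finset (Fin N → Fin c → Fin 3)) {h : ℕ}
    (hU : ∀ T ∈ S.𝒯α, 10 * ((S.holePairsIn A T).card * M ^ (N - 1)) ≤ (h + 1) * M ^ N) :
    ∃ ω : VxxzSeed M N, S.B.card * S.𝒯α.card ≤ 2 * M ^ 2 * ((S.present ω).filter fun T => (S.holes ω T ∩ A).card ≤ h).card := by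
  have hsum : S.B.card * S.𝒯α.card * M ^ N ≤ 2 * ∑ ω : VxxzSeed M N,
      ((S.present ω).filter fun T => (S.holes ω T ∩ A).card ≤ h).card := by
    have hswap : ∑ ω : VxxzSeed M N, ((S.B ×ˢ S.𝒯α).filter fun bT =>
        bT.2 ∈ S.present ω ∧ InBucket (2 * c) ω bT.2 bT.1 ∧ (S.holes ω bT.2 ∩ A).card ≤ h).card =
        ∑ bT ∈ S.B ×ˢ S.𝒯α, (univ.filter fun ω : VxxzSeed M N =>
          bT.2 ∈ S.present ω ∧ InBucket (2 * c) ω bT.2 bT.1 ∧ (S.holes ω bT.2 ∩ A).card ≤ h).card := by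
      simp only [card_filter]
      rw [sum_comm]
    calc S.B.card * S.𝒯α.card * M ^ N = ∑ _bT ∈ S.B ×ˢ S.𝒯α, M ^ N := by
          rw [sum_const, card_product, smul_eq_mul]
      _ ≤ ∑ bT ∈ S.B ×ˢ S.𝒯α, 2 * (univ.filter fun ω : VxxzSeed M N =>
            bT.2 ∈ S.present ω ∧ InBucket (2 * c) ω bT.2 bT.1 ∧ (S.holes ω bT.2 ∩ A).card ≤ h).card :=
          sum_le_sum fun bT hbT => card_seeds_goodIn_ge hS h𝒯 hM hcM hN hB hdegX hdegY A (mem_product.1 hbT).2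
            (mem_product.1 hbT).1 (hU _ (mem_product.1 hbT).2)
      _ = 2 * ∑ ω : VxxzSeed M N, ((S.present ω).filter fun T => (S.holes ω T ∩ A).card ≤ h).card := by
          rw [← mul_sum, ← hswap]
          congr 1
          exact sum_congr rfl fun ω _ => card_filter_product_goodIn_eq h𝒯 hM hB hS.subset A ω h
  by_contra hcon
  simp only [not_exists, not_le] at hcon
  have hlt : ∑ ω : VxxzSeed M N, 2 * M ^ 2 * ((S.present ω).filter fun T => (S.holes ω T ∩ A).card ≤ h).card <
      ∑ _ω : VxxzSeed M N, S.B.card * S.𝒯α.card :=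
    sum_lt_sum_of_nonempty univ_nonempty fun ω _ => hcon ω
  rw [sum_const, card_univ, card_vxxzSeed, smul_eq_mul, ← mul_sum] at hlt
  have : M ^ (N + 2) * (S.B.card * S.𝒯α.card) ≤
      2 * M ^ 2 * ∑ ω : VxxzSeed M N, ((S.present ω).filter fun T => (S.holes ω T ∩ A).card ≤ h).card := by
    calc M ^ (N + 2) * (S.B.card * S.𝒯α.card) = M ^ 2 * (S.B.card * S.𝒯α.card * M ^ N) := by ring
      _ ≤ M ^ 2 * (2 * ∑ ω : VxxzSeed M N, ((S.present ω).filter fun T => (S.holes ω T ∩ A).card ≤ h).card) :=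
          Nat.mul_le_mul_left _ hsum
      _ = _ := by ring
  exact absurd (lt_of_le_of_lt this hlt) (lt_irrefl _)

end HashedZeroOut

end Literature.Computability.AlgebraicComplexity
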